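import Summits.CriticalPhenomena.PercolationContinuityZ3.Theorems.PercNearOneGluingNoHeavyQuantTransportMenu
import Summits.CriticalPhenomena.PercolationContinuityZ3.Theorems.PercNearOneGluingNoHeavyQuantIndepBlobCloudSubtypeBridge
import HarnessLib

/-!
# QUANT lane R8, Conjecture DIB\* — CONDITIONED (sub-cloud) TRANSPORT: the Hall + antipodal-Harris injection restricted to the
# blobs of high gate, the other blobs riding along; the 'adaptive threshold' transport item for the mid floors

builds on p205010 (kernel theorem, internal audit signed; external expert review pending)

Support file (`--supports stmt-CriticalPhenomena-4575`), QUANT lane typer seat prim-quant-stmt (gen 21); sequel of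
`…QuantTransportCell` / `…QuantTransportLight` / `…QuantTransportMenu` (p275739, p278166, p279311).  Theorems only, no definitions,
no sorries, standard axioms; vocabulary of `…QuantIndepBlobGapCalculus` (restricted weights `∏_{i∈U} (if i ∈ s then p i else 1 − p i)` on
`U.powerset`) and `…QuantRootReduction` (`TERM`).

WHY.  The transport of the previous files uses the LEAST gate `g₀` of the whole rest (`g₀ = x²` for DIB\*): its ratio `(g₀/(1 − g₀))^k`
is `≥ 1/(1 − x)` only from `x ≈ 0.845` on (`k = 2`).  At mid floors the credit is carried by blobs of HIGHER gate, and the right item is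
the same injection restricted to a sub-finset `G` of reliable blobs (gates `≥ g₁`, `g₁ ≥ 1/2` as large as the mass condition allows),
CONDITIONALLY on the configuration of the other blobs: for every open mass `u` outside `G` the configurations of `G` of mass `≤ ℓ − u`
inject into those of mass `≥ m − u`, adding `≥ k` gates each time — the thresholds shift together, so Hall's condition `ℓ + m ≤ Σ_G a`
and the count condition `(k − 1)s + ℓ + 1 ≤ m` do not see `u`.  Numerically (seat folder work/explore/tr8.py) this 'adaptive' transport
item is what makes the single-split FS menu {inductive rows, Cantelli, half-mean} complete on the residual class at EVERY floor
(0 failures in 64 adversarial climbs, `x ∈ (1/2, 7/8)`; without it 7/10 climbs fail).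

* `IndepBlob.lowU_insert`, `uppU_insert` — conditioning the shifted restricted tails on one more blob.
* `IndepBlob.transport_sub_restricted` — on `G` itself (bridge to the subtype `↥G` + `transport_two_tails`), for every shift `u`.
* **`IndepBlob.transport_sub`** — for every finset `U ⊇ G` (the blobs of `U ∖ G` have arbitrary gates in `[0,1]`) and every shift `u`:
  `g₁^k · Σ_{s ⊆ U} w_U(s)·1[a(s) + u ≤ ℓ] ≤ (1 − g₁)^k · Σ_{s ⊆ U} w_U(s)·1[m ≤ a(s) + u]`.
* **`IndepBlob.transport_sub_univ`** — the whole system: `g₁^k · P(N ≤ ℓ) ≤ (1 − g₁)^k · P(N ≥ m)` as soon as SOME finset `G` of blobs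
  with gates `≥ g₁ ≥ 1/2`, sizes `≤ s`, has mass `≥ ℓ + m` and `(k − 1)s + ℓ + 1 ≤ m`.
* **`RootDec.term_ge_of_transport_sub_lower`** — the largest-blob split with the conditioned transport and any certified upper tail
  `h` of the rest (the mid-floor master rule): `g₁^k·p + h·(g₁^k(1 − p) − p(1 − g₁)^k) ≤ g₁^k·P(N ≥ j+1)`;
  **`RootDec.term_ge_of_transport_sub`** — the heavy form: `x ≤ p`, `(1 − g₁)^k ≤ (1 − x)g₁^k` ⟹ `x ≤ P(N ≥ j+1)`.
[this work]; the gluing rows served [cite: KozmaNitzan2024, Conjecture 3 (p. 15)]; product weights [cite: Grimmett1999, §1.3 p. 10].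
-/

namespace Summit.CriticalPhenomena.PercolationContinuityZ3.Theorems

namespace Quant

namespace IndepBlob

open Finset

variable {κ : Type*} [DecidableEq κ]

/-- restricted product-Bernoulli weight of `s` inside `U` (as in `…QuantIndepBlobGapCalculus`) -/
local notation3 "wU[" p ", " U ", " s "]" => ∏ i ∈ (U : Finset κ), (if i ∈ (s : Finset κ) then (p : κ → ℝ) i else 1 - (p : κ → ℝ) i)

/-- shifted LOWER restricted tail `P_U(a(s) + u ≤ ℓ)` -/
local notation3 "LOW[" p ", " a ", " U ", " u ", " ℓ "]" =>
  ∑ s ∈ (U : Finset κ).powerset, wU[p, U, s] * (if ∑ i ∈ s, (a : κ → ℕ) i + (u : ℕ) ≤ (ℓ : ℕ) then (1 : ℝ) else 0)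

/-- shifted UPPER restricted tail `P_U(m ≤ a(s) + u)` -/
local notation3 "UPP[" p ", " a ", " U ", " u ", " m "]" =>
  ∑ s ∈ (U : Finset κ).powerset, wU[p, U, s] * (if (m : ℕ) ≤ ∑ i ∈ s, (a : κ → ℕ) i + (u : ℕ) then (1 : ℝ) else 0)

/-! ### 1. Conditioning the shifted tails on one blob -/

/-- `LOW_{U+k}(u) = p k·LOW_U(u + a k) + (1 − p k)·LOW_U(u)` for `k ∉ U`. [this work] -/
theorem lowU_insert (p : κ → ℝ) (a : κ → ℕ) (U : Finset κ) (k : κ) (hk : k ∉ U) (u ℓ : ℕ) :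
    LOW[p, a, insert k U, u, ℓ] = p k * LOW[p, a, U, u + a k, ℓ] + (1 - p k) * LOW[p, a, U, u, ℓ] := by
  rw [sum_powerset_weight_insert p U k hk]
  congr 2
  refine Finset.sum_congr rfl fun s hs => ?_
  have hks : k ∉ s := fun h => hk (Finset.mem_powerset.mp hs h)
  rw [Finset.sum_insert hks, show a k + ∑ i ∈ s, a i + u = ∑ i ∈ s, a i + (u + a k) by ring]

/-- `UPP_{U+k}(u) = p k·UPP_U(u + a k) + (1 − p k)·UPP_U(u)` for `k ∉ U`. [this work] -/
theorem uppU_insert (p : κ → ℝ) (a : κ → ℕ) (U : Finset κ) (k : κ) (hk : k ∉ U) (u m : ℕ) :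
    UPP[p, a, insert k U, u, m] = p k * UPP[p, a, U, u + a k, m] + (1 - p k) * UPP[p, a, U, u, m] := by
  rw [sum_powerset_weight_insert p U k hk]
  congr 2
  refine Finset.sum_congr rfl fun s hs => ?_
  have hks : k ∉ s := fun h => hk (Finset.mem_powerset.mp hs h)
  rw [Finset.sum_insert hks, show a k + ∑ i ∈ s, a i + u = ∑ i ∈ s, a i + (u + a k) by ring]

/-- `0 ≤ UPP_U(u)` (gates of `U` in `[0,1]`). [this work] -/
theorem uppU_nonneg (p : κ → ℝ) (a : κ → ℕ) (U : Finset κ) (hp0 : ∀ i ∈ U, 0 ≤ p i) (hp1 : ∀ i ∈ U, p i ≤ 1) (u m : ℕ) :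
    0 ≤ UPP[p, a, U, u, m] :=
  Finset.sum_nonneg fun s _ => mul_nonneg (weightU_nonneg p U hp0 hp1 s) (by split_ifs <;> norm_num)

/-! ### 2. The transport on the reliable sub-cloud itself -/

/-- **Transport on `G`, every shift.**  Gates of `G` in `[g₁, 1]` with `g₁ ≥ 1/2`, sizes of `G` at most `s`, `ℓ + m ≤ Σ_G a`,
`(k − 1)s + ℓ + 1 ≤ m`.  Then for every `u`: `g₁^k · LOW_G(u, ℓ) ≤ (1 − g₁)^k · UPP_G(u, m)` (`transport_two_tails` on the subtype `↥G`
with thresholds `ℓ − u`, `m − u`; for `u > ℓ` the left side vanishes). [this work] -/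
theorem transport_sub_restricted (p : κ → ℝ) (a : κ → ℕ) (G : Finset κ) (g₁ : ℝ) (hhalf : 1 / 2 ≤ g₁)
    (hpG : ∀ i ∈ G, g₁ ≤ p i) (hp1G : ∀ i ∈ G, p i ≤ 1) (ℓ m s k : ℕ) (hmass : ℓ + m ≤ ∑ i ∈ G, a i)
    (hsize : ∀ i ∈ G, a i ≤ s) (hk : (k - 1) * s + ℓ + 1 ≤ m) (u : ℕ) :
    g₁ ^ k * LOW[p, a, G, u, ℓ] ≤ (1 - g₁) ^ k * UPP[p, a, G, u, m] := by
  have hg₁0 : 0 < g₁ := by linarith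
  have hp0G : ∀ i ∈ G, 0 ≤ p i := fun i hi => hg₁0.le.trans (hpG i hi)
  by_cases hu : ℓ < u
  · -- the lower family is empty
    have h0 : LOW[p, a, G, u, ℓ] = 0 := by
      refine Finset.sum_eq_zero fun s _ => ?_
      rw [if_neg (by omega), mul_zero]
    rw [h0, mul_zero]
    have hg₁1 : g₁ ≤ 1 := by
      rcases G.eq_empty_or_nonempty with h | ⟨i, hi⟩
      · rw [h, Finset.sum_empty] at hmass; omega
      · exact (hpG i hi).trans (hp1G i hi)
    exact mul_nonneg (pow_nonneg (by linarith) k) (uppU_nonneg p a G hp0G hp1G u m)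
  have hu' : u ≤ ℓ := not_lt.1 hu
  -- pass to the subtype `↥G`
  set p' : ↥G → ℝ := fun i => p i.1 with hp'
  set a' : ↥G → ℕ := fun i => a i.1 with ha'
  have hbrL : LOW[p, a, G, u, ℓ] = ∑ W ∈ (Finset.univ : Finset (Finset ↥G)).filter (fun W => ∑ i ∈ W, a' i ≤ ℓ - u),
      (∏ i : ↥G, if i ∈ W then p' i else 1 - p' i) := by
    rw [sum_powerset_eq_sum_subtype G, Finset.sum_filter]
    refine Finset.sum_congr rfl fun W _ => ?_
    have hmem : ∀ i : ↥G, (i.1 ∈ W.map (Function.Embedding.subtype _)) ↔ i ∈ W := by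
      intro i; constructor
      · intro h; rw [Finset.mem_map] at h; obtain ⟨j', hj, hji⟩ := h
        have : j' = i := Subtype.ext hji
        rw [← this]; exact hj
      · intro h; exact Finset.mem_map.2 ⟨i, h, rfl⟩
    have hprod : wU[p, G, W.map (Function.Embedding.subtype _)] = ∏ i : ↥G, (if i ∈ W then p' i else 1 - p' i) := by
      rw [← Finset.prod_coe_sort G]
      refine Finset.prod_congr rfl fun i _ => ?_
      by_cases h : i ∈ W
      · rw [if_pos ((hmem i).2 h), if_pos h]
      · rw [if_neg (fun h' => h ((hmem i).1 h')), if_neg h]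
    have hsum : ∑ i ∈ W.map (Function.Embedding.subtype _), a i = ∑ i ∈ W, a' i := by rw [Finset.sum_map]; rfl
    rw [hprod, hsum]
    by_cases h : ∑ i ∈ W, a' i + u ≤ ℓ
    · rw [if_pos h, if_pos (by omega), mul_one]
    · rw [if_neg h, if_neg (by omega), mul_zero]
  have hbrU : UPP[p, a, G, u, m] = ∑ W ∈ (Finset.univ : Finset (Finset ↥G)).filter (fun W => m - u ≤ ∑ i ∈ W, a' i),
      (∏ i : ↥G, if i ∈ W then p' i else 1 - p' i) := by
    rw [sum_powerset_eq_sum_subtype G, Finset.sum_filter]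
    refine Finset.sum_congr rfl fun W _ => ?_
    have hmem : ∀ i : ↥G, (i.1 ∈ W.map (Function.Embedding.subtype _)) ↔ i ∈ W := by
      intro i; constructor
      · intro h; rw [Finset.mem_map] at h; obtain ⟨j', hj, hji⟩ := h
        have : j' = i := Subtype.ext hji
        rw [← this]; exact hj
      · intro h; exact Finset.mem_map.2 ⟨i, h, rfl⟩
    have hprod : wU[p, G, W.map (Function.Embedding.subtype _)] = ∏ i : ↥G, (if i ∈ W then p' i else 1 - p' i) := by
      rw [← Finset.prod_coe_sort G]
      refine Finset.prod_congr rfl fun i _ => ?_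
      by_cases h : i ∈ W
      · rw [if_pos ((hmem i).2 h), if_pos h]
      · rw [if_neg (fun h' => h ((hmem i).1 h')), if_neg h]
    have hsum : ∑ i ∈ W.map (Function.Embedding.subtype _), a i = ∑ i ∈ W, a' i := by rw [Finset.sum_map]; rfl
    rw [hprod, hsum]
    by_cases h : m ≤ ∑ i ∈ W, a' i + u
    · rw [if_pos h, if_pos (by omega), mul_one]
    · rw [if_neg h, if_neg (by omega), mul_zero]
  rw [hbrL, hbrU]
  have hsumG : ∑ i : ↥G, a' i = ∑ i ∈ G, a i := by rw [ha']; exact Finset.sum_coe_sort G a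
  refine transport_two_tails p' a' g₁ hhalf (fun i => hpG i.1 i.2) (fun i => hp1G i.1 i.2) (ℓ - u) (m - u) s k ?_
    (fun i => hsize i.1 i.2) ?_
  · rw [hsumG]; omega
  · omega

/-! ### 3. Letting the other blobs ride along -/

/-- **Conditioned transport.**  With `G` as in `transport_sub_restricted` and any finset `E` disjoint from `G` whose gates are in `[0,1]`:
for every shift `u`, `g₁^k · LOW_{G ∪ E}(u, ℓ) ≤ (1 − g₁)^k · UPP_{G ∪ E}(u, m)` (induction on `E`: both tails condition on a blob of
`E` by the same convex combination of the shifts `u` and `u + a k`). [this work] -/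
theorem transport_sub (p : κ → ℝ) (a : κ → ℕ) (G : Finset κ) (g₁ : ℝ) (hhalf : 1 / 2 ≤ g₁)
    (hpG : ∀ i ∈ G, g₁ ≤ p i) (hp1G : ∀ i ∈ G, p i ≤ 1) (ℓ m s k : ℕ) (hmass : ℓ + m ≤ ∑ i ∈ G, a i)
    (hsize : ∀ i ∈ G, a i ≤ s) (hk : (k - 1) * s + ℓ + 1 ≤ m)
    (E : Finset κ) (hE : Disjoint E G) (hp0E : ∀ i ∈ E, 0 ≤ p i) (hp1E : ∀ i ∈ E, p i ≤ 1) (u : ℕ) :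
    g₁ ^ k * LOW[p, a, G ∪ E, u, ℓ] ≤ (1 - g₁) ^ k * UPP[p, a, G ∪ E, u, m] := by
  induction E using Finset.induction_on generalizing u with
  | empty =>
    rw [Finset.union_empty]
    exact transport_sub_restricted p a G g₁ hhalf hpG hp1G ℓ m s k hmass hsize hk u
  | @insert k' E hk'E ih =>
    have hk'G : k' ∉ G := fun h => (Finset.disjoint_left.1 hE (Finset.mem_insert_self k' E)) h
    have hEG : Disjoint E G := Finset.disjoint_of_subset_left (Finset.subset_insert k' E) hE
    have hk'U : k' ∉ G ∪ E := by
      rw [Finset.mem_union, not_or]; exact ⟨hk'G, hk'E⟩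
    have ih' := ih hEG (fun i hi => hp0E i (Finset.mem_insert_of_mem hi)) (fun i hi => hp1E i (Finset.mem_insert_of_mem hi))
    have hp0 : 0 ≤ p k' := hp0E k' (Finset.mem_insert_self k' E)
    have hp1 : p k' ≤ 1 := hp1E k' (Finset.mem_insert_self k' E)
    rw [Finset.union_insert, lowU_insert p a (G ∪ E) k' hk'U, uppU_insert p a (G ∪ E) k' hk'U]
    have h1 := mul_le_mul_of_nonneg_left (ih' (u + a k')) hp0
    have h2 := mul_le_mul_of_nonneg_left (ih' u) (sub_nonneg.2 hp1)
    nlinarith [h1, h2]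

/-- **Conditioned transport for the whole system** (`κ` finite): if SOME finset `G` of blobs has gates in `[g₁, 1]` with `g₁ ≥ 1/2`, sizes
`≤ s`, mass `≥ ℓ + m`, and `(k − 1)s + ℓ + 1 ≤ m`, while all gates are in `[0,1]`, then
`g₁^k · P(N ≤ ℓ) ≤ (1 − g₁)^k · P(N ≥ m)`. [this work] -/
theorem transport_sub_univ [Fintype κ] (p : κ → ℝ) (a : κ → ℕ) (hp0 : ∀ i, 0 ≤ p i) (hp1 : ∀ i, p i ≤ 1)
    (G : Finset κ) (g₁ : ℝ) (hhalf : 1 / 2 ≤ g₁) (hpG : ∀ i ∈ G, g₁ ≤ p i) (ℓ m s k : ℕ) (hmass : ℓ + m ≤ ∑ i ∈ G, a i)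
    (hsize : ∀ i ∈ G, a i ≤ s) (hk : (k - 1) * s + ℓ + 1 ≤ m) :
    g₁ ^ k * (∑ W ∈ (Finset.univ : Finset (Finset κ)).filter (fun W => ∑ i ∈ W, a i ≤ ℓ),
        (∏ t, if t ∈ W then p t else 1 - p t)) ≤
      (1 - g₁) ^ k * (∑ V ∈ (Finset.univ : Finset (Finset κ)).filter (fun V => m ≤ ∑ i ∈ V, a i),
        (∏ t, if t ∈ V then p t else 1 - p t)) := by
  have h := transport_sub p a G g₁ hhalf hpG (fun i _ => hp1 i) ℓ m s k hmass hsize hk (Finset.univ \ G)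
    Finset.sdiff_disjoint (fun i _ => hp0 i) (fun i _ => hp1 i) 0
  rw [Finset.union_sdiff_of_subset (Finset.subset_univ G)] at h
  have eL : LOW[p, a, (Finset.univ : Finset κ), 0, ℓ] = ∑ W ∈ (Finset.univ : Finset (Finset κ)).filter (fun W => ∑ i ∈ W, a i ≤ ℓ),
      (∏ t, if t ∈ W then p t else 1 - p t) := by
    rw [Finset.powerset_univ, Finset.sum_filter]
    refine Finset.sum_congr rfl fun W _ => ?_
    simp only [add_zero]
    split_ifs <;> simp
  have eU : UPP[p, a, (Finset.univ : Finset κ), 0, m] = ∑ V ∈ (Finset.univ : Finset (Finset κ)).filter (fun V => m ≤ ∑ i ∈ V, a i),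
      (∏ t, if t ∈ V then p t else 1 - p t) := by
    rw [Finset.powerset_univ, Finset.sum_filter]
    refine Finset.sum_congr rfl fun W _ => ?_
    simp only [add_zero]
    split_ifs <;> simp
  rw [eL, eU] at h
  exact h

end IndepBlob

namespace RootDec

open Finset

variable {κ : Type} [Fintype κ] [DecidableEq κ]

/-- product-Bernoulli weight of the set `W` of open blobs (as in `…QuantRootReduction`) -/
local notation3 "wt[" g ", " W "]" => ∏ k, (if k ∈ (W : Finset κ) then (g : κ → ℝ) k else 1 - (g : κ → ℝ) k)

/-- the TERM tail `P(s + Σ_{k open} a k ≥ j+1)` (as in `…QuantRootReduction`) -/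
local notation3 "TERM[" s ", " a ", " g ", " j "]" =>
  ∑ W : Finset κ, wt[g, W] * (if (j : ℕ) + 1 ≤ (s : ℕ) + ∑ k ∈ W, (a : κ → ℕ) k then (1 : ℝ) else 0)

/-! ### 4. The largest-blob split with the conditioned transport -/

/-- **Mid-floor master rule.**  Gates in `[0,1]`; split blob `k₀` with `b = a k₀ ≤ j`, gate `p = g k₀`; a finset `G` of OTHER blobs
(`k₀ ∉ G`) with gates `≥ g₁ ≥ 1/2`, sizes `≤ s`, `(k − 1)s ≤ b`, and mass `Σ_G a ≥ 2j + 1 − b`; any certified `h ≤ P(N_rest ≥ j+1)`; the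
sign condition `p(1 − g₁)^k ≤ (1 − p)g₁^k`.  Then `g₁^k·p + h·(g₁^k(1 − p) − p(1 − g₁)^k) ≤ g₁^k·P(N ≥ j+1)`. [this work] -/
theorem term_ge_of_transport_sub_lower (a : κ → ℕ) (g : κ → ℝ) (j : ℕ) (g₁ h : ℝ) (k₀ : κ) (G : Finset κ) (s k : ℕ)
    (hg : ∀ i, 0 ≤ g i ∧ g i ≤ 1) (hhalf : 1 / 2 ≤ g₁) (hG : ∀ i ∈ G, g₁ ≤ g i) (hk₀G : k₀ ∉ G)
    (hkj : a k₀ ≤ j) (hsize : ∀ i ∈ G, a i ≤ s) (hk : (k - 1) * s ≤ a k₀)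
    (hmass : 2 * j + 1 ≤ a k₀ + ∑ i ∈ G, a i)
    (hsign : g k₀ * (1 - g₁) ^ k ≤ (1 - g k₀) * g₁ ^ k)
    (hh : h ≤ ∑ W : Finset κ, wt[g, W] * (if j + 1 ≤ ∑ i ∈ W, Function.update a k₀ 0 i then (1 : ℝ) else 0)) :
    g₁ ^ k * g k₀ + h * (g₁ ^ k * (1 - g k₀) - g k₀ * (1 - g₁) ^ k) ≤
      g₁ ^ k * ∑ W : Finset κ, wt[g, W] * (if j + 1 ≤ ∑ i ∈ W, a i then (1 : ℝ) else 0) := by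
  have hg₁0 : 0 < g₁ := by linarith
  set b : ℕ := a k₀ with hb
  set a' : κ → ℕ := Function.update a k₀ 0 with ha'
  have ha'k : a' k₀ = 0 := by rw [ha', Function.update_self]
  have ha'ne : ∀ i, i ≠ k₀ → a' i = a i := fun i hi => by rw [ha', Function.update_of_ne hi]
  have ha'G : ∀ i ∈ G, a' i = a i := fun i hi => ha'ne i (fun h => hk₀G (h ▸ hi))
  have hsumG : ∑ i ∈ G, a' i = ∑ i ∈ G, a i := Finset.sum_congr rfl ha'G
  have hmass' : (j - b) + (j + 1) ≤ ∑ i ∈ G, a' i := by rw [hsumG]; omega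
  set L : ℝ := ∑ W ∈ (Finset.univ : Finset (Finset κ)).filter (fun W => ∑ i ∈ W, a' i ≤ j - b), wt[g, W] with hL
  set H : ℝ := ∑ V ∈ (Finset.univ : Finset (Finset κ)).filter (fun V => j + 1 ≤ ∑ i ∈ V, a' i), wt[g, V] with hH
  have htr : g₁ ^ k * L ≤ (1 - g₁) ^ k * H :=
    IndepBlob.transport_sub_univ g a' (fun i => (hg i).1) (fun i => (hg i).2) G g₁ hhalf hG (j - b) (j + 1) s k hmass'
      (fun i hi => (ha'G i hi).le.trans (hsize i hi)) (by omega)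
  have hT1 : TERM[b, a', g, j] = 1 - L := by
    rw [term_shift b a' g j hkj, hL, Finset.sum_filter, eq_sub_iff_add_eq, ← Finset.sum_add_distrib]
    refine Eq.trans (Finset.sum_congr rfl fun W _ => ?_) (IndepBlob.sum_bernoulliWeight g)
    by_cases h : j - b + 1 ≤ ∑ i ∈ W, a' i
    · rw [if_pos h, if_neg (by omega), mul_one, add_zero]
    · rw [if_neg h, if_pos (by omega), mul_zero, zero_add]
  have hT0 : ∑ W : Finset κ, wt[g, W] * (if j + 1 ≤ ∑ i ∈ W, a' i then (1 : ℝ) else 0) = H := by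
    rw [hH, Finset.sum_filter]
    refine Finset.sum_congr rfl fun W _ => ?_
    split_ifs <;> simp
  have hhH : h ≤ H := hh.trans_eq hT0
  have e := term_cond 0 a g j k₀
  simp only [zero_add] at e
  rw [e, show a k₀ = b from rfl, show Function.update a k₀ 0 = a' from rfl, hT1, hT0]
  set p : ℝ := g k₀ with hp
  set c : ℝ := g₁ ^ k with hc
  set d : ℝ := (1 - g₁) ^ k with hd
  have hp0 : 0 ≤ p := (hg k₀).1
  have hpLH : p * (c * L) ≤ p * (d * H) := mul_le_mul_of_nonneg_left htr hp0
  have key : c * (p * (1 - L) + (1 - p) * H) - (c * p + h * (c * (1 - p) - p * d)) =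
      (p * (d * H) - p * (c * L)) + (H - h) * (c * (1 - p) - p * d) := by ring
  have hbr : 0 ≤ c * (1 - p) - p * d := by rw [hc, hd]; linarith
  nlinarith [mul_nonneg (sub_nonneg.2 hhH) hbr]

/-- **Conditioned transport, heavy form.**  As in `term_ge_of_transport_sub_lower` without `h`, with `x ≤ g k₀` and the floor condition
`(1 − g₁)^k ≤ (1 − x)·g₁^k`: then `x ≤ P(N ≥ j+1)` (`P ≥ min(p, 1 − p(1 − g₁)^k/g₁^k)`). [this work] -/
theorem term_ge_of_transport_sub (a : κ → ℕ) (g : κ → ℝ) (j : ℕ) (x g₁ : ℝ) (k₀ : κ) (G : Finset κ) (s k : ℕ)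
    (hg : ∀ i, 0 ≤ g i ∧ g i ≤ 1) (hhalf : 1 / 2 ≤ g₁) (hG : ∀ i ∈ G, g₁ ≤ g i) (hk₀G : k₀ ∉ G)
    (hx : x ≤ g k₀) (hkj : a k₀ ≤ j) (hsize : ∀ i ∈ G, a i ≤ s) (hk : (k - 1) * s ≤ a k₀)
    (hmass : 2 * j + 1 ≤ a k₀ + ∑ i ∈ G, a i) (hρ : (1 - g₁) ^ k ≤ (1 - x) * g₁ ^ k) :
    x ≤ ∑ W : Finset κ, wt[g, W] * (if j + 1 ≤ ∑ i ∈ W, a i then (1 : ℝ) else 0) := by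
  have hg₁0 : 0 < g₁ := by linarith
  have hGne : G.Nonempty := by
    rcases G.eq_empty_or_nonempty with h | h
    · rw [h, Finset.sum_empty] at hmass; omega
    · exact h
  obtain ⟨i₁, hi₁⟩ := hGne
  have hg₁1 : g₁ ≤ 1 := (hG i₁ hi₁).trans (hg i₁).2
  set p : ℝ := g k₀ with hp
  set c : ℝ := g₁ ^ k with hc
  set d : ℝ := (1 - g₁) ^ k with hd
  have hc0 : 0 < c := pow_pos hg₁0 k
  have hp1 : p ≤ 1 := (hg k₀).2
  have hw0 : ∀ W : Finset κ, 0 ≤ wt[g, W] := IndepBlob.bernoulliWeight_nonneg (fun i => (hg i).1) (fun i => (hg i).2)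
  have hP1 : ∑ W : Finset κ, wt[g, W] * (if j + 1 ≤ ∑ i ∈ W, a i then (1 : ℝ) else 0) ≤ 1 :=
    (Finset.sum_le_sum fun W _ => mul_le_of_le_one_right (hw0 W) (by split_ifs <;> norm_num)).trans_eq
      (IndepBlob.sum_bernoulliWeight g)
  by_cases hcase : p * d ≤ (1 - p) * c
  · -- `h = 0`: `P ≥ p ≥ x`
    have h0 : (0 : ℝ) ≤ ∑ W : Finset κ, wt[g, W] * (if j + 1 ≤ ∑ i ∈ W, Function.update a k₀ 0 i then (1 : ℝ) else 0) :=
      Finset.sum_nonneg fun W _ => mul_nonneg (hw0 W) (by split_ifs <;> norm_num)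
    have hmain := term_ge_of_transport_sub_lower a g j g₁ 0 k₀ G s k hg hhalf hG hk₀G hkj hsize hk hmass hcase h0
    rw [zero_mul, add_zero] at hmain
    have : c * x ≤ c * p := mul_le_mul_of_nonneg_left hx hc0.le
    exact le_of_mul_le_mul_left (this.trans hmain) hc0
  · -- `P ≥ 1 − p·d/c ≥ x`: rerun the split with the trivial bound `H ≤ 1`
    have hg1le : d ≤ (1 - x) * c := hρ
    set b : ℕ := a k₀ with hb
    set a' : κ → ℕ := Function.update a k₀ 0 with ha'
    have ha'k : a' k₀ = 0 := by rw [ha', Function.update_self]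
    have ha'ne : ∀ i, i ≠ k₀ → a' i = a i := fun i hi => by rw [ha', Function.update_of_ne hi]
    have ha'G : ∀ i ∈ G, a' i = a i := fun i hi => ha'ne i (fun h => hk₀G (h ▸ hi))
    have hsumG : ∑ i ∈ G, a' i = ∑ i ∈ G, a i := Finset.sum_congr rfl ha'G
    have hmass' : (j - b) + (j + 1) ≤ ∑ i ∈ G, a' i := by rw [hsumG]; omega
    set L : ℝ := ∑ W ∈ (Finset.univ : Finset (Finset κ)).filter (fun W => ∑ i ∈ W, a' i ≤ j - b), wt[g, W] with hL
    set H : ℝ := ∑ V ∈ (Finset.univ : Finset (Finset κ)).filter (fun V => j + 1 ≤ ∑ i ∈ V, a' i), wt[g, V] with hH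
    have htr : c * L ≤ d * H :=
      IndepBlob.transport_sub_univ g a' (fun i => (hg i).1) (fun i => (hg i).2) G g₁ hhalf hG (j - b) (j + 1) s k hmass'
        (fun i hi => (ha'G i hi).le.trans (hsize i hi)) (by omega)
    have hL0 : 0 ≤ L := Finset.sum_nonneg fun W _ => hw0 W
    have hH1 : H ≤ 1 := (Finset.sum_le_sum_of_subset_of_nonneg (Finset.filter_subset _ _) fun W _ _ => hw0 W).trans_eq
      (IndepBlob.sum_bernoulliWeight g)
    have hT1 : TERM[b, a', g, j] = 1 - L := by
      rw [term_shift b a' g j hkj, hL, Finset.sum_filter, eq_sub_iff_add_eq, ← Finset.sum_add_distrib]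
      refine Eq.trans (Finset.sum_congr rfl fun W _ => ?_) (IndepBlob.sum_bernoulliWeight g)
      by_cases h : j - b + 1 ≤ ∑ i ∈ W, a' i
      · rw [if_pos h, if_neg (by omega), mul_one, add_zero]
      · rw [if_neg h, if_pos (by omega), mul_zero, zero_add]
    have hT0 : ∑ W : Finset κ, wt[g, W] * (if j + 1 ≤ ∑ i ∈ W, a' i then (1 : ℝ) else 0) = H := by
      rw [hH, Finset.sum_filter]
      refine Finset.sum_congr rfl fun W _ => ?_
      split_ifs <;> simp
    have e := term_cond 0 a g j k₀
    simp only [zero_add] at e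
    rw [e, show a k₀ = b from rfl, show Function.update a k₀ 0 = a' from rfl, hT1, hT0]
    have hcase' : (1 - p) * c ≤ p * d := (not_le.1 hcase).le
    have hp0 : 0 ≤ p := (hg k₀).1
    have hpLH : p * (c * L) ≤ p * (d * H) := mul_le_mul_of_nonneg_left htr hp0
    have hd0 : 0 ≤ d := by rw [hd]; exact pow_nonneg (by linarith) k
    have key : c * (p * (1 - L) + (1 - p) * H) - c * x =
        (p * (d * H) - p * (c * L)) + (1 - H) * (p * d - c * (1 - p)) + (c * (1 - x) - p * d) := by ring
    have h3 : p * d ≤ c * (1 - x) := (mul_le_of_le_one_left hd0 hp1).trans (hg1le.trans_eq (mul_comm _ _))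
    have hmain : c * x ≤ c * (p * (1 - L) + (1 - p) * H) := by
      nlinarith [mul_nonneg (sub_nonneg.2 hH1) (by linarith : 0 ≤ p * d - c * (1 - p))]
    exact le_of_mul_le_mul_left hmain hc0

end RootDec

end Quant

end Summit.CriticalPhenomena.PercolationContinuityZ3.Theorems
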